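import Summits.ABC.IUTFork.Cor312HullGluedDHVolContainerSharp
import Summits.ABC.IUTFork.Cor312NegLogThetaUpperPrVolLocal
import Summits.ABC.IUTFork.Cor312HullVolumePrVolScaled
import HarnessLib

/-!
# [IUTchIII] Cor. 3.12 — the hull-gluing bracket WITHOUT `hst` at the PRINT-NORMALISED sharp setting of record
# (`Real.settingPrVolSharp`, the certificate setting): packet window and `−|log(Θ)| ≤ −|log(Θ)|♮ ≤ −|log(Θ)| + E`

PROOF-ONLY sequel (abc-iut cell, seat abc-iut-w5-d082, WAVE-5; row «HULLGLUED-CONTAINER») of this seat's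
`Cor312HullGluedDHVolContainerSharp` (the bracket at abc-iut-c312-5's `Real.settingDHVolSharp`), at abc-iut-c312-7's
PRINT-NORMALISED twin `Real.settingPrVolSharp` (abc-iut-c312-1's probability weights `Pr(v⃗)`, Dupuy–Hilado §3.6; the
setting of branch C's certificates). TAKES NO SIDE on [IUTchIII] Cor. 3.12; no definition, no `Prop` fact.

The two settings share frames, (Ind1)/(Ind2) orbits and pilot regions — only the weights differ — so every SET-level
statement transfers definitionally (abc-iut-c312-5 gen 5's `stable_thetaHull_settingPrVolSharp_of_not_dvd` is the
unramified `hst` of `settingDHVolSharp` by `exact`); the volumes are re-read in the packet-normalised container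
(abc-iut-w4-d107 `logvol_situationPrVol_preimage_hullSet_algebraMap`: `μ^log(e⁻¹(c·𝒪_L)) = log ‖c‖`, no weight factor):

* §1 `hullGlued_hullDefined_settingPrVolSharp` (every label packet), `hullGlued_thetaFinite_settingPrVolSharp`
  (`−|log(Θ)|♮ ∈ ℝ`; agreement of the local Θ-volumes off `2·disc(F)` via c312-5's `hst`),
  `hullGlued_statement_settingPrVolSharp_of_statement` (`P.Statement → P♮.Statement`, abc-iut-w5-d060's
  `hullGlued_statement_of_mono`);
* §2 **`hullGlued_thetaLocal_window_settingPrVolSharp`** — at EVERY prime `p` and label `i₀+1`, `‖t_{Θ,i₀+1,v}‖ ≤ ρ` over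
  `p`, `r`/`R` inner/outer coordinate radii of the log-shell lattice:
  `Σ_{v⃗} Pr(v⃗)·log‖t_{Θ,i₀+1,v_{i₀+1}}‖ ≤ μ^log(^{n,∘}𝒰_{i₀+1,p}) ≤ μ^log(^{n,∘}𝒰♮_{i₀+1,p}) ≤ log(p⁴·R²·ρ/r²)`;
* §3 **`hullGlued_negLogTheta_window_settingPrVolSharp`** — `−|log(Θ)| ≤ −|log(Θ)|♮ ≤ −|log(Θ)| + E`,
  `E = processionNormalized (i ↦ Σ_{p ∣ 2·disc(F)} (log(p⁴·R_{p,i}²·ρ_{p,i}/r_{p,i}²) − μ^log(^{n,∘}𝒰_{i+1,p})))`, NO `hst`/`hbad`;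
  **`negLogQ_le_negLogTheta_add_settingPrVolSharp_of_hullGlued_statement`** (`P♮.Statement ⇒ −|log(q)| ≤ −|log(Θ)| + E`).
Reading (neutral): at the certificate setting the pinned-hull reading `P♮` raises `−|log(Θ)|` by AT MOST the explicit
finite excess `E` of [IUTchIV] Thm. 1.10 Step (v) container terms at the packets above `2·disc(F)`; nothing here asserts
either Statement or constrains the Θ-glue. [claim: Mochizuki2012, status: disputed] vocabulary only.
[cite: Mochizuki2012, IUTchIV Thm 1.10 proof Step (v) pp. 27–29, Prop. 1.4 (iii) p. 13] [cite: DupuyHilado2025, §3.6, §3.9, §4.10]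
-/

noncomputable section

open Set Function NumberField
open scoped Pointwise

namespace Summit.ABC.IUTFork.Thm311.Real

open Cor312 Cor312.Setting Cor312Vol Literature.IUT.LogThetaLattice Literature.IUT.LogVolume

variable {F : Type} [Field F] [NumberField F] (X : PilotData F) {logv : PadicLogs F} (hlog : LogvAnalytic logv)
  (t : ∀ (pp : Nat.Primes) (_ : Fin X.lstar) (x : (thetaIndex X).Fibre (.inr pp)),
    haveI : Fact (pp : ℕ).Prime := ⟨pp.2⟩; kOf X pp.1 x)
  (tq : ∀ (pp : Nat.Primes) (x : (thetaIndex X).Fibre (.inr pp)),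
    haveI : Fact (pp : ℕ).Prime := ⟨pp.2⟩; kOf X pp.1 x)
  (M : Type) [Field M] [NumberField M]
  (archPk : ∀ (j : (thetaIndex X).Label) (vQ : (thetaIndex X).VQ), Set ((logShellsDH X logv).Packet j vQ))
  (archSub : ∀ (j : (thetaIndex X).Label) (v : (thetaIndex X).V),
    Set ((logShellsDH X logv).Packet j ((thetaIndex X).over v)))
  (Ψ : ℤ → ∀ v : (thetaIndex X).V, v ∈ (thetaIndex X).Vbad → Set ((logShellsDH X logv).StarPacket v))
  (act : ℤ → ∀ v : (thetaIndex X).V, v ∈ (thetaIndex X).Vbad →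
    (logShellsDH X logv).StarPacket v → Module.End ℚ ((logShellsDH X logv).StarPacket v))
  (Mmod : ℤ → ∀ j : (thetaIndex X).LabelStar, Set ((logShellsDH X logv).GlobalPacket j.1))
  (region : ℤ → ∀ j : (thetaIndex X).LabelStar, FinDivisor M → ∀ vQ : (thetaIndex X).VQ,
    Set ((logShellsDH X logv).Packet j.1 vQ))
  (n : ℤ) {HT : Type} {LogLink : HT → HT → Type} {IsFull : ∀ {s t : HT}, LogLink s t → Prop}
  (lat : LGPGaussianLogThetaLattice LogLink IsFull)
  {Frd : Type} {IsoF : Frd → Frd → Type} {Ob : Frd → Type} {realify : Frd → Frd} {Strip : Type}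
  {IsoS : Strip → Strip → Type} {Mv : ∀ v : (thetaIndex X).V, v ∈ (thetaIndex X).Vbad → Type}
  [∀ v h, Monoid (Mv v h)]
  (sig : GlobalLGPFrobenioidSignature (thetaIndex X).lstar (thetaIndex X).V (· ∈ (thetaIndex X).Vbad)
    Frd IsoF Ob realify Strip IsoS Mv)
  (split : SplittingMonoids Mv) {ObΔ : Type} {N : ∀ v : (thetaIndex X).V, v ∈ (thetaIndex X).Vbad → Type}
  [∀ v h, Monoid (N v h)] (qData : QPilotData ObΔ N)
  (ht0 : ∀ pp i x, t pp i x ≠ 0)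
  (ht1 : ∀ (pp : Nat.Primes) (i : Fin X.lstar) (x : (thetaIndex X).Fibre (.inr pp)),
    haveI : Fact (pp : ℕ).Prime := ⟨pp.2⟩; placeOf X pp.1 x ∉ X.S → ‖t pp i x‖ = 1)
  (htq0 : ∀ pp x, tq pp x ≠ 0)
  (htq1 : ∀ (pp : Nat.Primes) (x : (thetaIndex X).Fibre (.inr pp)),
    haveI : Fact (pp : ℕ).Prime := ⟨pp.2⟩; placeOf X pp.1 x ∉ X.S → ‖tq pp x‖ = 1)

/-! ## 1. `HullDefined♮`, `ThetaFinite♮` and the Statement transfer at the print-normalised sharp setting -/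

include ht0 ht1 in
/-- **`HullDefined♮` at every label packet of the print-normalised sharp setting** — the same frames and orbits as
`settingDHVolSharp` (abc-iut-w5-d060 `hullGlued_hullDefined_settingDHVol`, transferred definitionally).
[claim: Mochizuki2012, status: disputed] -/
theorem hullGlued_hullDefined_settingPrVolSharp (i : Fin (thetaIndex X).lstar) (vQ : (thetaIndex X).VQ) :
    (settingPrVolSharp X hlog M archPk archSub Ψ act Mmod region n lat sig split qData tq t htq0
      htq1).hullGlued.HullDefined (labelSucc i) vQ :=
  hullGlued_hullDefined_settingDHVol X hlog M archPk archSub Ψ act Mmod region n lat sig split qData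
    (fun _ _ => thetaBoxDH X hlog (sharpBoxDH X hlog t)) (fun _ => qCentreDH X hlog tq) (qCentreDH_ne_zero X hlog tq htq0)
    (finite_support_logvol_qRegion X hlog M archPk archSub Ψ act Mmod region n tq htq0 htq1) (labelSucc i) vQ
    (hullDefined_of_finite (bridgeHyps_settingDHVolSharp_of_ideles X hlog t tq M archPk archSub Ψ act Mmod region n lat
      sig split qData ht0 ht1 htq0 htq1) i vQ)

include ht0 in
/-- Where `^{n,∘}𝒰` is (Ind1),(Ind2)-stable — i.e. at every label packet NOT above `2·disc(F)` (abc-iut-c312-5 gen 5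
`stable_thetaHull_settingPrVolSharp_of_not_dvd`; archimedean packets: everything) — the local Θ-volumes of the
print-normalised sharp setting and of its hull-gluing AGREE (p424693). [claim: Mochizuki2012, status: disputed] -/
theorem hullGlued_thetaLocal_eq_settingPrVolSharp_of_not_dvd (i : Fin (thetaIndex X).lstar) (vQ : (thetaIndex X).VQ)
    (hvQ : ∀ pp : Nat.Primes, vQ = .inr pp → ¬ (pp : ℕ) ∣ 2 * (NumberField.discr F).natAbs)
    (hdef : (settingPrVolSharp X hlog M archPk archSub Ψ act Mmod region n lat sig split qData tq t htq0
      htq1).HullDefined (labelSucc i) vQ) :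
    (settingPrVolSharp X hlog M archPk archSub Ψ act Mmod region n lat sig split qData tq t htq0
        htq1).hullGlued.thetaLocal (labelSucc i) vQ =
      (settingPrVolSharp X hlog M archPk archSub Ψ act Mmod region n lat sig split qData tq t htq0
        htq1).thetaLocal (labelSucc i) vQ := by
  set P := settingPrVolSharp X hlog M archPk archSub Ψ act Mmod region n lat sig split qData tq t htq0 htq1 with hP
  have hHas : ∀ H' ∈ (P.frame (labelSucc i) vQ).Hul, (P.frame (labelSucc i) vQ).HasHull H' :=
    (Setting.frameHyps_ofComparison_of_surjective n lat sig split qData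
      (realPiecesPr X hlog M archPk archSub Ψ act Mmod region (fun _ _ => thetaBoxDH X hlog (sharpBoxDH X hlog t))
        (fun _ => qCentreDH X hlog tq))
      (qCentreDH_ne_zero X hlog tq htq0) (hadm_Pr X hlog M archPk archSub Ψ act Mmod region n)
      (finite_support_logvol_qRegion_Pr X hlog M archPk archSub Ψ act Mmod region n tq htq0 htq1)
      (fun i vQ => factorMapDH_surjective' X hlog (labelSucc i) vQ) i vQ).1
  have hst : ∀ Φ ∈ Setting.indGroup (situationPrVol X hlog M archPk archSub Ψ act Mmod region),
      Φ (labelSucc i) vQ '' P.thetaHull (labelSucc i) vQ = P.thetaHull (labelSucc i) vQ :=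
    stable_thetaHull_settingDHVolSharp_of_not_dvd X hlog t tq M archPk archSub Ψ act Mmod region n lat sig split qData
      ht0 htq0 htq1 i vQ hvQ
  exact (P.hullGlued_hullDefined_thetaLocal_of_stable hst hHas hdef).2

include ht0 ht1 in
/-- **`−|log(Θ)|♮ ∈ ℝ` at the print-normalised sharp setting**: `ThetaFinite` for the hull-gluing (abc-iut-w5-d060's
`hullGlued_thetaFinite_of_agree_off_finite`: `ThetaFinite` for the setting, `HullDefined♮` everywhere, agreement off the
primes dividing `2·|disc(F)|`). [claim: Mochizuki2012, status: disputed] -/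
theorem hullGlued_thetaFinite_settingPrVolSharp :
    (settingPrVolSharp X hlog M archPk archSub Ψ act Mmod region n lat sig split qData tq t htq0
      htq1).hullGlued.ThetaFinite := by
  set P := settingPrVolSharp X hlog M archPk archSub Ψ act Mmod region n lat sig split qData tq t htq0 htq1 with hP
  have hfin : P.ThetaFinite :=
    thetaFinite_settingPrVolSharp X hlog M archPk archSub Ψ act Mmod region n lat sig split qData t tq ht0 ht1 htq0 htq1
  have hdef : ∀ (i : Fin (thetaIndex X).lstar) (vQ : (thetaIndex X).VQ), P.HullDefined (labelSucc i) vQ :=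
    fun i vQ => by
    by_contra hd
    exact hfin.1 i vQ (by unfold Setting.thetaLocal; rw [if_neg hd])
  refine P.hullGlued_thetaFinite_of_agree_off_finite hfin
    (fun i vQ => hullGlued_hullDefined_settingPrVolSharp X hlog t tq M archPk archSub Ψ act Mmod region n lat sig split
      qData ht0 ht1 htq0 htq1 i vQ)
    (fun _ => Sum.inr '' {pp : Nat.Primes | (pp : ℕ) ∣ 2 * (NumberField.discr F).natAbs})
    (fun _ => (finite_primes_dvd_two_mul_discr (F := F)).image _) (fun i vQ hvQ => ?_)
  refine hullGlued_thetaLocal_eq_settingPrVolSharp_of_not_dvd X hlog t tq M archPk archSub Ψ act Mmod region n lat sig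
    split qData ht0 htq0 htq1 i vQ (fun pp h hdvd => hvQ ?_) (hdef i vQ)
  exact ⟨pp, hdvd, h.symm⟩

include ht0 ht1 in
/-- **At the print-normalised sharp setting the typed Corollary 3.12 IMPLIES the typed Corollary 3.12 for its
hull-gluing** (`−|log(q)| ≤ −|log(Θ)| ≤ −|log(Θ)|♮`; abc-iut-w5-d060's `hullGlued_statement_of_mono`). Neither Statement
is asserted. [claim: Mochizuki2012, status: disputed] -/
theorem hullGlued_statement_settingPrVolSharp_of_statement
    (h : (settingPrVolSharp X hlog M archPk archSub Ψ act Mmod region n lat sig split qData tq t htq0 htq1).Statement) :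
    (settingPrVolSharp X hlog M archPk archSub Ψ act Mmod region n lat sig split qData tq t htq0
      htq1).hullGlued.Statement :=
  hullGlued_statement_of_mono
    (bridgeHyps_settingPrVolSharp_of_ideles X hlog M archPk archSub Ψ act Mmod region n lat sig split qData t tq ht0 ht1
      htq0 htq1).mono
    (hullGlued_thetaFinite_settingPrVolSharp X hlog t tq M archPk archSub Ψ act Mmod region n lat sig split qData ht0 ht1
      htq0 htq1) h

/-! ## 2. The packet window at the print-normalised sharp setting, ANY prime -/

include ht0 ht1 in
/-- **Box ≤ hull ≤ glued hull ≤ container at EVERY prime of the print-normalised sharp setting.** At the packet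
`(i₀+1, p)`, with `‖t_{Θ,i₀+1,v}‖ ≤ ρ` over `p` and inner/outer coordinate radii `r`, `R` of the log-shell lattice:
`Σ_{v⃗} Pr(v⃗)·log‖t_{Θ,i₀+1,v_{i₀+1}}‖ ≤ μ^log(^{n,∘}𝒰_{i₀+1,p}) ≤ μ^log(^{n,∘}𝒰♮_{i₀+1,p}) ≤ log(p⁴·R²·ρ/r²)` (the container is
this seat's `hullGlued_thetaHull_settingDHVol_subset_hullSet_of_polydisc`, transferred definitionally; its packet-normalised
volume is abc-iut-w4-d107's `log ‖c‖`). No stability of `^{n,∘}𝒰`. [claim: Mochizuki2012, status: disputed]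
[cite: Mochizuki2012, IUTchIV Thm 1.10 proof Step (v) pp. 27–29] [cite: DupuyHilado2025, §3.6, §3.9, §4.10] -/
theorem hullGlued_thetaLocal_window_settingPrVolSharp (pp : Nat.Primes) (i₀ : Fin (thetaIndex X).lstar)
    {r R ρ : ℝ} (hr : 0 < r) (hR : 0 < R) (hρ : 0 < ρ)
    (hball : haveI : Fact (pp : ℕ).Prime := ⟨pp.2⟩
      ∀ z : (∀ s : (presAt X hlog pp).factorIdx (labelSucc i₀), (presAt X hlog pp).factorField (labelSucc i₀) s),
        (∀ s, ‖z s‖ < r) → z ∈ (presAt X hlog pp).latticeF (labelSucc i₀) 1)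
    (hbdd : haveI : Fact (pp : ℕ).Prime := ⟨pp.2⟩
      ∀ z ∈ (presAt X hlog pp).latticeF (labelSucc i₀) 1, ∀ s, ‖z s‖ ≤ R)
    (hΘ : haveI : Fact (pp : ℕ).Prime := ⟨pp.2⟩; ∀ x : (thetaIndex X).Fibre (.inr pp), ‖t pp i₀ x‖ ≤ ρ) :
    haveI : Fact (pp : ℕ).Prime := ⟨pp.2⟩
    (∑ e : (presAt X hlog pp).toLocalPieces.E (labelSucc i₀),
        weightPr X pp.1 (labelSucc i₀) e * Real.log ‖t pp i₀ (e (Fin.last _))‖ ≤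
      ((settingPrVolSharp X hlog M archPk archSub Ψ act Mmod region n lat sig split qData tq t htq0
        htq1).thetaLocal (labelSucc i₀) (.inr pp)).untopD 0) ∧
    (((settingPrVolSharp X hlog M archPk archSub Ψ act Mmod region n lat sig split qData tq t htq0
        htq1).thetaLocal (labelSucc i₀) (.inr pp)).untopD 0 ≤
      ((settingPrVolSharp X hlog M archPk archSub Ψ act Mmod region n lat sig split qData tq t htq0
        htq1).hullGlued.thetaLocal (labelSucc i₀) (.inr pp)).untopD 0) ∧
    (((settingPrVolSharp X hlog M archPk archSub Ψ act Mmod region n lat sig split qData tq t htq0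
        htq1).hullGlued.thetaLocal (labelSucc i₀) (.inr pp)).untopD 0 ≤
      Real.log (((pp : ℕ) : ℝ) ^ 4 * R ^ 2 * ρ / r ^ 2)) := by
  haveI : Fact (pp : ℕ).Prime := ⟨pp.2⟩
  set P := settingPrVolSharp X hlog M archPk archSub Ψ act Mmod region n lat sig split qData tq t htq0 htq1 with hP
  set Pp := presAt X hlog pp with hPp
  set j : (thetaIndex X).Label := labelSucc i₀ with hj
  have hp1 : (1 : ℝ) < (pp : ℕ) := by exact_mod_cast (Fact.out : (pp : ℕ).Prime).one_lt
  have hp0 : (0 : ℝ) < (pp : ℕ) := zero_lt_one.trans hp1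
  have hpne : ((pp : ℕ) : ℚ_[pp]) ≠ 0 := by exact_mod_cast (Fact.out : (pp : ℕ).Prime).ne_zero
  have H : BridgeHyps P :=
    bridgeHyps_settingPrVolSharp_of_ideles X hlog M archPk archSub Ψ act Mmod region n lat sig split qData t tq ht0 ht1
      htq0 htq1
  have hdef : P.HullDefined j (.inr pp) := hullDefined_of_finite H i₀ (.inr pp)
  have hdef' : P.hullGlued.HullDefined j (.inr pp) :=
    hullGlued_hullDefined_settingPrVolSharp X hlog t tq M archPk archSub Ψ act Mmod region n lat sig split qData ht0 ht1
      htq0 htq1 i₀ (.inr pp)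
  refine ⟨?_, ?_, ?_⟩
  · -- box ≤ hull
    rw [thetaLocal_untopD H i₀ (.inr pp)]
    have hbox := logvol_thetaRegion3_sharp_Pr_inr X hlog M archPk archSub Ψ act Mmod region n lat sig split qData
      (fun _ => qCentreDH X hlog tq) (qCentreDH_ne_zero X hlog tq htq0)
      (finite_support_logvol_qRegion_Pr X hlog M archPk archSub Ψ act Mmod region n tq htq0 htq1) t ht0 i₀ pp
    refine (le_of_eq hbox.symm).trans ?_
    exact H.mono i₀ (.inr pp)
      (adm_thetaRegion3_sharp_Pr X hlog M archPk archSub Ψ act Mmod region n lat sig split qData _ _ _ t ht0 _ _)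
      (P.thetaHull_adm hdef)
      ((P.thetaRegion3_subset_sUnion _ _).trans ((P.frame _ _).subset_hull _))
  · -- hull ≤ glued hull (abc-iut-w5-d060, monotone volumes)
    have hle := thetaLocal_le_hullGlued_thetaLocal H.mono i₀ (.inr pp) hdef hdef'
    unfold Setting.thetaLocal at hle ⊢
    rw [if_pos hdef, if_pos hdef'] at hle
    rw [if_pos hdef, if_pos hdef', WithTop.untopD_coe, WithTop.untopD_coe]
    exact WithTop.coe_le_coe.1 hle
  · -- glued hull ≤ container: the DH container, transferred definitionally, read in the packet-normalised volumes
    obtain ⟨N', hN', hsub'⟩ := hullGlued_thetaHull_settingDHVol_subset_hullSet_of_polydisc X hlog M archPk archSub Ψ act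
      Mmod region n lat sig split qData (fun _ _ => thetaBoxDH X hlog (sharpBoxDH X hlog t)) (fun _ => qCentreDH X hlog tq)
      (qCentreDH_ne_zero X hlog tq htq0)
      (finite_support_logvol_qRegion X hlog M archPk archSub Ψ act Mmod region n tq htq0 htq1) pp i₀ hr hR hρ hball hbdd
      (fun _ => thetaBoxDH_sharpBoxDH_subset_of_norm_le X hlog t ht0 pp i₀ hΘ)
    have hsubPr : P.hullGlued.thetaHull j (.inr pp) ⊆
        (fun x => Pp.factorMap j x) ⁻¹' hullSet (Pp.factorField j)
          (fun s => algebraMap ℚ_[pp] (Pp.factorField j s) (((pp : ℕ) : ℚ_[pp]) ^ (-N'))) := hsub'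
    have hlam_ne : ∀ s : Pp.factorIdx j, algebraMap ℚ_[pp] (Pp.factorField j s) (((pp : ℕ) : ℚ_[pp]) ^ (-N')) ≠ 0 :=
      fun s => (map_ne_zero _).2 (zpow_ne_zero _ hpne)
    have hHul : (fun x => Pp.factorMap j x) ⁻¹' hullSet (Pp.factorField j)
        (fun s => algebraMap ℚ_[pp] (Pp.factorField j s) (((pp : ℕ) : ℚ_[pp]) ^ (-N'))) ∈ (P.frame j (.inr pp)).Hul :=
      ⟨_, ⟨_, hlam_ne, rfl⟩, rfl⟩
    unfold Setting.thetaLocal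
    rw [if_pos hdef', WithTop.untopD_coe]
    refine ((H.mono i₀ (.inr pp) (P.hullGlued.thetaHull_adm hdef') (P.hul_adm _ _ _ hHul) hsubPr).trans_eq ?_).trans
      (Real.log_le_log (zpow_pos hp0 N') hN')
    have hvol := logvol_situationPrVol_preimage_hullSet_algebraMap X hlog M archPk archSub Ψ act Mmod region n pp j
      (((pp : ℕ) : ℚ_[pp]) ^ (-N')) (zpow_ne_zero _ hpne)
    rw [Padic.norm_p_zpow, neg_neg] at hvol
    exact hvol

/-! ## 3. Globally: `−|log(Θ)| ≤ −|log(Θ)|♮ ≤ −|log(Θ)| + E` at the print-normalised sharp setting -/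

include ht0 ht1 in
open scoped Classical in
/-- **`−|log(Θ)| ≤ −|log(Θ)|♮ ≤ −|log(Θ)| + E` at the PRINT-NORMALISED sharp setting of record, NO `hst`/`hbad`**, with
`E = processionNormalized (i ↦ Σ_{p ∣ 2·disc(F)} (log(p⁴·R_{p,i}²·ρ_{p,i}/r_{p,i}²) − μ^log(^{n,∘}𝒰_{i+1,p})))` for any radii
`r`, `R` of the log-shell lattices and bounds `ρ` of the Θ-idele norms at the packets above `2·disc(F)` (the
[IUTchIV] Thm. 1.10 Step (v) container excess; elsewhere the local Θ-volumes agree).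
[claim: Mochizuki2012, status: disputed] [cite: Mochizuki2012, IUTchIV Thm 1.10 proof Step (v) pp. 27–29]
[cite: DupuyHilado2025, §3.6, §4.10] -/
theorem hullGlued_negLogTheta_window_settingPrVolSharp (r R ρ : Nat.Primes → Fin (thetaIndex X).lstar → ℝ)
    (hr : ∀ pp i, 0 < r pp i) (hR : ∀ pp i, 0 < R pp i) (hρ : ∀ pp i, 0 < ρ pp i)
    (hball : ∀ (pp : Nat.Primes) (i : Fin (thetaIndex X).lstar), haveI : Fact (pp : ℕ).Prime := ⟨pp.2⟩
      ∀ z : (∀ s : (presAt X hlog pp).factorIdx (labelSucc i), (presAt X hlog pp).factorField (labelSucc i) s),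
        (∀ s, ‖z s‖ < r pp i) → z ∈ (presAt X hlog pp).latticeF (labelSucc i) 1)
    (hbdd : ∀ (pp : Nat.Primes) (i : Fin (thetaIndex X).lstar), haveI : Fact (pp : ℕ).Prime := ⟨pp.2⟩
      ∀ z ∈ (presAt X hlog pp).latticeF (labelSucc i) 1, ∀ s, ‖z s‖ ≤ R pp i)
    (hΘ : ∀ (pp : Nat.Primes) (i : Fin (thetaIndex X).lstar) (x : (thetaIndex X).Fibre (.inr pp)),
      haveI : Fact (pp : ℕ).Prime := ⟨pp.2⟩; ‖t pp i x‖ ≤ ρ pp i) :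
    (settingPrVolSharp X hlog M archPk archSub Ψ act Mmod region n lat sig split qData tq t htq0 htq1).negLogTheta ≤
      (settingPrVolSharp X hlog M archPk archSub Ψ act Mmod region n lat sig split qData tq t htq0
        htq1).hullGlued.negLogTheta ∧
    (settingPrVolSharp X hlog M archPk archSub Ψ act Mmod region n lat sig split qData tq t htq0
        htq1).hullGlued.negLogTheta ≤
      (settingPrVolSharp X hlog M archPk archSub Ψ act Mmod region n lat sig split qData tq t htq0 htq1).negLogTheta +
        ((processionNormalized fun i : Fin (thetaIndex X).lstar => ∑ᶠ vQ : (thetaIndex X).VQ,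
          (match vQ with
            | .inl _ => (0 : ℝ)
            | .inr pp =>
                if (pp : ℕ) ∣ 2 * (NumberField.discr F).natAbs then
                  Real.log (((pp : ℕ) : ℝ) ^ 4 * R pp i ^ 2 * ρ pp i / r pp i ^ 2) -
                    ((settingPrVolSharp X hlog M archPk archSub Ψ act Mmod region n lat sig split qData tq t htq0
                      htq1).thetaLocal (labelSucc i) (.inr pp)).untopD 0
                else 0) : ℝ) : WithTop ℝ) := by
  set P := settingPrVolSharp X hlog M archPk archSub Ψ act Mmod region n lat sig split qData tq t htq0 htq1 with hP
  have H : BridgeHyps P :=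
    bridgeHyps_settingPrVolSharp_of_ideles X hlog M archPk archSub Ψ act Mmod region n lat sig split qData t tq ht0 ht1
      htq0 htq1
  have hfin : P.ThetaFinite :=
    thetaFinite_settingPrVolSharp X hlog M archPk archSub Ψ act Mmod region n lat sig split qData t tq ht0 ht1 htq0 htq1
  have hfin' : P.hullGlued.ThetaFinite :=
    hullGlued_thetaFinite_settingPrVolSharp X hlog t tq M archPk archSub Ψ act Mmod region n lat sig split qData ht0 ht1
      htq0 htq1
  have hdef : ∀ (i : Fin (thetaIndex X).lstar) (vQ : (thetaIndex X).VQ), P.HullDefined (labelSucc i) vQ :=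
    fun i vQ => hullDefined_of_finite H i vQ
  refine hullGlued_negLogTheta_window _ (fun i => ?_) (fun i vQ => ?_) H.mono hfin hfin'
  · -- finite support: inside the primes dividing `2·|disc(F)|`
    refine ((finite_primes_dvd_two_mul_discr (F := F)).image Sum.inr).subset fun vQ hvQ => ?_
    have hne := Function.mem_support.mp hvQ
    rcases vQ with u | pp
    · exact absurd rfl hne
    · by_cases hdvd : (pp : ℕ) ∣ 2 * (NumberField.discr F).natAbs
      · exact ⟨pp, hdvd, rfl⟩
      · exact absurd (if_neg hdvd) hne
  · -- the packet excesses
    rcases vQ with u | pp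
    · rw [add_zero, hullGlued_thetaLocal_eq_settingPrVolSharp_of_not_dvd X hlog t tq M archPk archSub Ψ act Mmod
        region n lat sig split qData ht0 htq0 htq1 i (.inl u) (fun pp h => by cases h) (hdef i _)]
    · haveI : Fact (pp : ℕ).Prime := ⟨pp.2⟩
      by_cases hdvd : (pp : ℕ) ∣ 2 * (NumberField.discr F).natAbs
      · simp only [hdvd, if_true, add_sub_cancel]
        exact (hullGlued_thetaLocal_window_settingPrVolSharp X hlog t tq M archPk archSub Ψ act Mmod region n lat sig
          split qData ht0 ht1 htq0 htq1 pp i (hr pp i) (hR pp i) (hρ pp i) (hball pp i) (hbdd pp i) (hΘ pp i)).2.2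
      · simp only [hdvd, if_false, add_zero]
        rw [hullGlued_thetaLocal_eq_settingPrVolSharp_of_not_dvd X hlog t tq M archPk archSub Ψ act Mmod region n lat
          sig split qData ht0 htq0 htq1 i (.inr pp) (fun pp' h => by cases h; exact hdvd) (hdef i _)]

include ht0 ht1 in
open scoped Classical in
/-- **At the print-normalised sharp setting, the typed Statement FOR THE HULL-GLUED SETTING gives
`−|log(q)| ≤ −|log(Θ)| + E` for the setting itself** (converse of `hullGlued_statement_settingPrVolSharp_of_statement`
up to the explicit excess `E` of §3). Neither Statement is asserted. [claim: Mochizuki2012, status: disputed]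
[cite: Mochizuki2012, IUTchIV Thm 1.10 proof Step (v) pp. 27–29] [cite: DupuyHilado2025, §4.10] -/
theorem negLogQ_le_negLogTheta_add_settingPrVolSharp_of_hullGlued_statement
    (r R ρ : Nat.Primes → Fin (thetaIndex X).lstar → ℝ)
    (hr : ∀ pp i, 0 < r pp i) (hR : ∀ pp i, 0 < R pp i) (hρ : ∀ pp i, 0 < ρ pp i)
    (hball : ∀ (pp : Nat.Primes) (i : Fin (thetaIndex X).lstar), haveI : Fact (pp : ℕ).Prime := ⟨pp.2⟩
      ∀ z : (∀ s : (presAt X hlog pp).factorIdx (labelSucc i), (presAt X hlog pp).factorField (labelSucc i) s),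
        (∀ s, ‖z s‖ < r pp i) → z ∈ (presAt X hlog pp).latticeF (labelSucc i) 1)
    (hbdd : ∀ (pp : Nat.Primes) (i : Fin (thetaIndex X).lstar), haveI : Fact (pp : ℕ).Prime := ⟨pp.2⟩
      ∀ z ∈ (presAt X hlog pp).latticeF (labelSucc i) 1, ∀ s, ‖z s‖ ≤ R pp i)
    (hΘ : ∀ (pp : Nat.Primes) (i : Fin (thetaIndex X).lstar) (x : (thetaIndex X).Fibre (.inr pp)),
      haveI : Fact (pp : ℕ).Prime := ⟨pp.2⟩; ‖t pp i x‖ ≤ ρ pp i)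
    (h' : (settingPrVolSharp X hlog M archPk archSub Ψ act Mmod region n lat sig split qData tq t htq0
      htq1).hullGlued.Statement) :
    (((settingPrVolSharp X hlog M archPk archSub Ψ act Mmod region n lat sig split qData tq t htq0 htq1).negLogQ : ℝ) :
        WithTop ℝ) ≤
      (settingPrVolSharp X hlog M archPk archSub Ψ act Mmod region n lat sig split qData tq t htq0 htq1).negLogTheta +
        ((processionNormalized fun i : Fin (thetaIndex X).lstar => ∑ᶠ vQ : (thetaIndex X).VQ,
          (match vQ with
            | .inl _ => (0 : ℝ)
            | .inr pp =>
                if (pp : ℕ) ∣ 2 * (NumberField.discr F).natAbs then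
                  Real.log (((pp : ℕ) : ℝ) ^ 4 * R pp i ^ 2 * ρ pp i / r pp i ^ 2) -
                    ((settingPrVolSharp X hlog M archPk archSub Ψ act Mmod region n lat sig split qData tq t htq0
                      htq1).thetaLocal (labelSucc i) (.inr pp)).untopD 0
                else 0) : ℝ) : WithTop ℝ) := by
  have h2 := h'.2
  rw [Setting.hullGlued_negLogQ] at h2
  exact h2.trans (hullGlued_negLogTheta_window_settingPrVolSharp X hlog t tq M archPk archSub Ψ act Mmod region n lat
    sig split qData ht0 ht1 htq0 htq1 r R ρ hr hR hρ hball hbdd hΘ).2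

end Summit.ABC.IUTFork.Thm311.Real

end
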